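/-
Copyright (c) 2026. Released under Apache 2.0 license as described in the file LICENSE.
Track B ∕ K2-LIT (cell `hodgecm-mathlib`, squad K2, ENGINE E1), crux h413 = `stmt-HodgeConjecture-24833`, route of record `HCCMUnconditional`.
Prover seat `hodgecm-mathlib-K2E3-p12` (g7).  Deal «P8 PROPER» (K2E1-plan (g5) 09:13:55Z), §1 of the closer: whole plane from the balls — ★-closed today.
-/
import Summits.HodgeConjecture.HodgeConjecture.Theorems.K2E1BLMeromorphicGluing        -- ★ G-a (this seat): `exists_meromorphicOn_univ_of_balls`
import Summits.HodgeConjecture.HodgeConjecture.Theorems.K2E1BorelEisensteinRegularU   -- ★ `differentiableOn_eisensteinSeriesU_flatSectionU_cm_two` (holomorphy on the Godement range)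
import HarnessLib

/-!
# K2·E1 — `K2E1SphericalEisensteinMeromorphicOfBallsU2`: THE WHOLE-PLANE MEROMORPHIC CONTINUATION OF THE SPHERICAL BOREL EISENSTEIN SERIES ON `U(1,1)` OVER A CM FIELD FROM
# PER-BALL CONTINUATIONS — the last (gluing) step of Bernstein–Lapid's closing argument [arXiv:1911.02342, §2.1 + §4 p. 10], ★-closed

Track B ∕ K2-LIT, crux h413 = `stmt-HodgeConjecture-24833`, route of record `HCCMUnconditional`; cell `hodgecm-mathlib`, squad K2, ENGINE E1 (campaign EIS-R7-BL-SPH-2, (ζ′) WIRING §3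
P8; dealer ruling 09:04:59Z (D-i)∕(D-ii): per ball ONE Hilbert-space system, glue through normal form).  Prover seat `hodgecm-mathlib-K2E3-p12` (g7).  THEOREMS ONLY (no `def`, no `instance`, no
notation, no named-fact hypothesis, no `sorry`); lane `--supports stmt-HodgeConjecture-24833 --as helper` (count-neutral).  Closes no socket.

THE MATHEMATICS.  `E(φ₀H^z)(g) = eisensteinSeriesU (flatSectionU (fun _ => φ₀) z) g` on `G = U(J₂)(𝔸_{L⁺})` (`quasiSplit L⁺ L c 2`) converges and is holomorphic in `z` on `{Re z > 1}` (★
`differentiableOn_eisensteinSeriesU_flatSectionU_cm_two`, unconditional).  Bernstein–Lapid's argument is run on each ball `D_n = ball 0 (n + 2)` (weight `k_n`, finite family of test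
functions — files G-b∕G-c∕P8 §2) and gives a scalar function meromorphic on `D_n` that equals `E(φ₀H^z)(g)` on `D_n ∩ {Re z > 1}`; ★ G-a `exists_meromorphicOn_univ_of_balls` patches the normal
forms of these pieces into ONE function meromorphic on `ℂ` (values on the Godement set untouched because the pieces are analytic there).
§1 **`sphericalEisenstein_meromorphic_of_balls`** — `(hball : ∀ n g, ∃ Ec, MeromorphicOn Ec (ball 0 (n+2)) ∧ ∀ z ∈ ball 0 (n+2), 1 < Re z → Ec z = E(φ₀H^z)(g))` ⟹ `∃ Ec : ℂ → (G → ℂ)`,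
`∀ g, MeromorphicOn (fun z => Ec z g) univ` and `∀ z, 1 < Re z → Ec z = E(φ₀H^z)` — the HEAD of the P8 closer with the per-ball conclusion as its only hypothesis; **`…_of_eventually_balls`**
(it suffices to have the pieces for all large `n`).
HONEST LABEL: HC_CM is proved only modulo the 7 printed citations (2 remaining named inputs: hLiu418 = `stmt-HodgeConjecture-24832`, h413 = `stmt-HodgeConjecture-24833`) until rung 0
closes; this file asserts no named fact and closes no socket.  NOT claimed: location of poles, functional equation (MS ∘ G2 files).
References: [BernsteinLapid2019] J. Bernstein, E. Lapid, *On the meromorphic continuation of Eisenstein series*, arXiv:1911.02342 (JAMS 37 (2024), doi:10.1090/jams/1020), §2.1, §4 p. 10 ·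
[MoeglinWaldspurger1995] C. Mœglin, J.-L. Waldspurger, *Spectral Decomposition and Eisenstein Series*, II.1.5, IV.1.8.
-/

set_option autoImplicit false
-- the mandated namespace repeats the single-problem summit's segment (`HodgeConjecture.HodgeConjecture`)
set_option linter.dupNamespace false

noncomputable section

open Set Filter Topology NumberField
open Literature.NumberTheory.Automorphic Literature.NumberTheory.Automorphic.UnitaryGroup
open Summit.HodgeConjecture.HodgeConjecture.Cruxes.H413.K2E1BorelEisensteinU
open Summit.HodgeConjecture.HodgeConjecture.Cruxes.H413.K2E1BLMeromorphicGluing (exists_meromorphicOn_univ_of_balls)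
open Summit.HodgeConjecture.HodgeConjecture.Cruxes.H413.K2E1BorelEisensteinRegularU (differentiableOn_eisensteinSeriesU_flatSectionU_cm_two)

namespace Summit.HodgeConjecture.HodgeConjecture.Cruxes.H413.K2E1SphericalEisensteinMeromorphicOfBallsU2

variable (L : Type) [Field L] [NumberField L] [IsCMField L]

/-- **WHOLE PLANE FROM THE BALLS** [BernsteinLapid2019, §2.1 + §4 p. 10].  If for every `n` and every `g ∈ U(J₂)(𝔸_{L⁺})` some scalar function meromorphic on `ball 0 (n + 2)` agrees with
`z ↦ E(φ₀H^z)(g)` on `ball 0 (n + 2) ∩ {1 < Re z}`, then there is `Ec : ℂ → (U(J₂)(𝔸_{L⁺}) → ℂ)`, meromorphic on ALL of `ℂ` in `z` for every `g`, with `Ec z = E(φ₀H^z)` for `1 < Re z`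
(★ G-a gluing through normal form; holomorphy of the Eisenstein series on the Godement range ★). [cite: BernsteinLapid2019, §2.1 and §4 p. 10] [cite: MoeglinWaldspurger1995, II.1.5] -/
theorem sphericalEisenstein_meromorphic_of_balls (φ₀ : ℂ)
    (hball : ∀ (n : ℕ) (g : (quasiSplit (↥(maximalRealSubfield L)) L (IsCMField.complexConj L) 2).Adelic), ∃ Ec : ℂ → ℂ,
      MeromorphicOn Ec (Metric.ball (0 : ℂ) (n + 2)) ∧ ∀ z ∈ Metric.ball (0 : ℂ) (n + 2), 1 < z.re →
        Ec z = eisensteinSeriesU (flatSectionU (fun _ : (quasiSplit (↥(maximalRealSubfield L)) L (IsCMField.complexConj L) 2).Adelic => φ₀) z) g) :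
    ∃ Ec : ℂ → (quasiSplit (↥(maximalRealSubfield L)) L (IsCMField.complexConj L) 2).Adelic → ℂ,
      (∀ g, MeromorphicOn (fun z => Ec z g) univ) ∧
      ∀ z : ℂ, 1 < z.re → Ec z = eisensteinSeriesU (flatSectionU (fun _ : (quasiSplit (↥(maximalRealSubfield L)) L (IsCMField.complexConj L) 2).Adelic => φ₀) z) := by
  have hglue : ∀ g : (quasiSplit (↥(maximalRealSubfield L)) L (IsCMField.complexConj L) 2).Adelic, ∃ G : ℂ → ℂ, MeromorphicOn G univ ∧
      ∀ z : ℂ, 1 < z.re → G z = eisensteinSeriesU (flatSectionU (fun _ : (quasiSplit (↥(maximalRealSubfield L)) L (IsCMField.complexConj L) 2).Adelic => φ₀) z) g := by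
    intro g
    choose F hF hFE using fun n : ℕ => hball n g
    obtain ⟨G, hG, hGE, -⟩ := exists_meromorphicOn_univ_of_balls
      (differentiableOn_eisensteinSeriesU_flatSectionU_cm_two L (φ := fun _ => φ₀) (M := ‖φ₀‖) (fun _ => le_rfl) g) hF hFE
    exact ⟨G, hG, hGE⟩
  choose G hG hGE using hglue
  exact ⟨fun z g => G g z, hG, fun z hz => funext fun g => hGE g z hz⟩

/-- Variant: pieces for all sufficiently large balls suffice (restrict a piece on `ball 0 (m + 2)`, `m ≥ n`, to `ball 0 (n + 2)`). [cite: BernsteinLapid2019, §2.1 and §4 p. 10] -/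
theorem sphericalEisenstein_meromorphic_of_eventually_balls (φ₀ : ℂ) (n₀ : ℕ)
    (hball : ∀ n : ℕ, n₀ ≤ n → ∀ g : (quasiSplit (↥(maximalRealSubfield L)) L (IsCMField.complexConj L) 2).Adelic, ∃ Ec : ℂ → ℂ,
      MeromorphicOn Ec (Metric.ball (0 : ℂ) (n + 2)) ∧ ∀ z ∈ Metric.ball (0 : ℂ) (n + 2), 1 < z.re →
        Ec z = eisensteinSeriesU (flatSectionU (fun _ : (quasiSplit (↥(maximalRealSubfield L)) L (IsCMField.complexConj L) 2).Adelic => φ₀) z) g) :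
    ∃ Ec : ℂ → (quasiSplit (↥(maximalRealSubfield L)) L (IsCMField.complexConj L) 2).Adelic → ℂ,
      (∀ g, MeromorphicOn (fun z => Ec z g) univ) ∧
      ∀ z : ℂ, 1 < z.re → Ec z = eisensteinSeriesU (flatSectionU (fun _ : (quasiSplit (↥(maximalRealSubfield L)) L (IsCMField.complexConj L) 2).Adelic => φ₀) z) := by
  refine sphericalEisenstein_meromorphic_of_balls L φ₀ fun n g => ?_
  obtain ⟨Ec, hEc, hEcE⟩ := hball (max n n₀) (le_max_right _ _) g
  have hsub : Metric.ball (0 : ℂ) (n + 2) ⊆ Metric.ball (0 : ℂ) ((max n n₀ : ℕ) + 2) :=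
    Metric.ball_subset_ball (by exact_mod_cast Nat.add_le_add_right (le_max_left n n₀) 2)
  exact ⟨Ec, hEc.mono_set hsub, fun z hz hz1 => hEcE z (hsub hz) hz1⟩

end Summit.HodgeConjecture.HodgeConjecture.Cruxes.H413.K2E1SphericalEisensteinMeromorphicOfBallsU2

end
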